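import Summits.HodgeConjecture.HodgeConjecture.Theses.HeckePrymWeil
import Literature.AlgebraicGeometry.HodgeTheory.MotivatedClassesProofs
import Literature.AlgebraicGeometry.HodgeTheory.MiddleDimensionReductionHolds
import Literature.AlgebraicGeometry.HodgeTheory.ComplexConjugationHolds
import Literature.AlgebraicGeometry.HodgeTheory.LefschetzOneOneHolds
import Summits.HodgeConjecture.HodgeConjecture.Theorems.PadicSemiregularLiftHodgeBeyondAnchorsMotivatedSplit
import Summits.HodgeConjecture.HodgeConjecture.Theorems.HeckeOrbitCompactnessAssembly
import HarnessLib.Audit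

/-!
# Split glue for the crux `HeckePrymWeil.SummitOffWeilSector` (stmt-HodgeConjecture-14374)

BC2-REDIRECT decomposition (crux-strategist r1, 2026-08-17) of the route's declared summit complement
`SummitOffWeilSector := WeilSector → HodgeConjecture` into the three children (VERBATIM the items of
route `MotivatedLefschetzSplit`, so that they deduplicate onto stmt-HodgeConjecture-17488 / 17489 /
17490 — one staffing):

* `HodgeClassesMotivated` (crux, stmt-17488) — every rational `(p,p)` class in the deep middle
  `2 ≤ p ≤ n/2` of a smooth projective complex `n`-fold is MOTIVATED (André 1996, Déf. 1);
* `LefschetzStandardB` (crux, stmt-17489) — Grothendieck's standard conjecture of Lefschetz type for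
  every smooth projective complex variety, André's `*_L`-form on the real carriers;
* `DiagonalPullbackAlgebraic` (support, stmt-17490; theorem in print, Voisin II Prop. 9.21 (i)) —
  pull-back along the diagonal preserves the coniveau.

The glue `summitOffWeilSector_of_subs : HM → B → Δ → SummitOffWeilSector` is André's remark
"`B` ⇒ `A_mot ⊆ A`" (§2.1; tree theorem
`motivatedClasses_le_algebraicClasses_of_standardConjectureB_of_map_diagonal`) in the deep middle,
Lefschetz `(1,1)` (tree theorem `lefschetzOneOne_rational_holds`) in codimension one, `N⁰H⁰ = H⁰`
(`algebraicClasses_zero`) in codimension zero, assembled by the reduction to the middle dimension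
(BFNP Lemma 48, tree theorem `middleDimensionReduction_holds`) with Hodge models
(`nonempty_hodgeModel_holds`). The Weil-sector hypothesis of the crux is discarded: it cannot be
load-bearing (Cruxes/SummitOffWeilSector/Disproof.lean §3; Negative/ConjectureGrade.lean).
Sorry-free; intended to be landed verbatim by a prover as
`Theorems/HeckePrymWeilSummitOffWeilSectorSplit.lean` (`--supports stmt-HodgeConjecture-14374`) and used
as `route edit --split SummitOffWeilSector … --glue-by`.

References: [Andre1996Motifs] Y. André, Pour une théorie inconditionnelle des motifs, Publ. Math.
IHÉS 83 (1996), §0.3–0.4, §2.1. [BrosnanFangNiePearlstein2009] Lemma 48. [VoisinHodgeII2003]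
Prop. 9.20–9.21. [VoisinHodgeI2002] Thm. 11.30 (Lefschetz (1,1)).
-/

noncomputable section

set_option linter.dupNamespace false

open CategoryTheory AlgebraicGeometry MonoidalCategory CartesianMonoidalCategory
open Literature.AlgebraicGeometry Literature.AlgebraicGeometry.Motives
  Literature.AlgebraicGeometry.HodgeTheory

namespace Summit.HodgeConjecture.HodgeConjecture.Cruxes.SummitOffWeilSector.SplitGlue

/-- **The Hodge conjecture from the three split children** (statements verbatim
stmt-HodgeConjecture-17488 / 17489 / 17490 — André's factorisation `HC ⟸ (Hodge ⇒ motivated) ∧ B`).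
Given `X` smooth projective of dimension `n` and a rational `(p,p)` class `c`: reduce to the middle
degree `p = m` of `2m`-folds (`hodgeConjectureFor_of_middleDimension` with
`middleDimensionReduction_holds` and `nonempty_hodgeModel_holds`); `m = 0`: `N⁰H⁰ = ⊤`
(`algebraicClasses_zero`); `m = 1`: Lefschetz `(1,1)` (`lefschetzOneOne_rational_holds`); `m ≥ 2`:
the class is motivated by `hM` and algebraic by André's `B ⇒ A_mot ⊆ A`
(`motivatedClasses_le_algebraicClasses_of_standardConjectureB_of_map_diagonal` fed `hΔ` and `hB`).
[cite: Andre1996Motifs, §2.1 remark following Déf. 1 (p. 14) and §0.3–0.4]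
[cite: BrosnanFangNiePearlstein2009, Lemma 48] [cite: VoisinHodgeI2002, Thm. 11.30] -/
theorem hodgeConjecture_of_subs
    (hM : ∀ ⦃n : ℕ⦄ ⦃X : Literature.AlgebraicGeometry.Motives.SchemeOver ℂ⦄,
      Literature.AlgebraicGeometry.Motives.IsSmoothProjective n X → ∀ p : ℕ, 2 ≤ p → 2 * p ≤ n →
        ∀ c : Literature.AlgebraicGeometry.HodgeTheory.complexBetti X (2 * p),
          Literature.AlgebraicGeometry.HodgeTheory.IsRationalClass c →
            Literature.AlgebraicGeometry.HodgeTheory.IsOfHodgeType n X (2 * p) p p c →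
              c ∈ Literature.AlgebraicGeometry.HodgeTheory.motivatedClasses n X p)
    (hB : ∀ (d : ℕ) (Z : Literature.AlgebraicGeometry.Motives.SchemeOver ℂ)
      (η : Literature.AlgebraicGeometry.HodgeTheory.complexBetti Z 2),
      Literature.AlgebraicGeometry.Motives.IsSmoothProjective d Z →
        Literature.AlgebraicGeometry.HodgeTheory.StandardConjectureBStar d Z η)
    (hΔ : ∀ ⦃d : ℕ⦄ ⦃V : Literature.AlgebraicGeometry.Motives.SchemeOver ℂ⦄,
      Literature.AlgebraicGeometry.Motives.IsSmoothProjective d V → ∀ (p : ℕ)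
        ⦃c : Literature.AlgebraicGeometry.HodgeTheory.complexBetti (V ⊗ V) (2 * p)⦄,
        c ∈ Literature.AlgebraicGeometry.HodgeTheory.algebraicClasses (V ⊗ V) p →
          Literature.AlgebraicGeometry.HodgeTheory.complexBetti.map (lift (𝟙 V) (𝟙 V)) (2 * p) c ∈
            Literature.AlgebraicGeometry.HodgeTheory.algebraicClasses V p) :
    _root_.HodgeConjecture := by
  intro n X hX
  refine hodgeConjectureFor_of_middleDimension middleDimensionReduction_holds
    (fun k Y hY ↦ (nonempty_hodgeModel_holds (n := k) (X := Y)).nonempty hY)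
    (fun m Y hY c hc hpp ↦ ?_) hX
  rcases Nat.lt_or_ge m 2 with hm | hm
  · interval_cases m
    · rw [algebraicClasses_zero]; exact Submodule.mem_top
    · exact lefschetzOneOne_rational_holds hY c hc hpp
  · exact motivatedClasses_le_algebraicClasses_of_standardConjectureB_of_map_diagonal hΔ hB hY m
      (hM hY m hm le_rfl c hc hpp)

/-- **The crux `SummitOffWeilSector` from its three split children** — the split glue
`HM → B → Δ → SummitOffWeilSector` for `route edit --split SummitOffWeilSector … --glue-by`. The
Weil-sector antecedent of the crux is discarded (it cannot be load-bearing: Disproof.lean §3); the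
consequent `HodgeConjecture` is `hodgeConjecture_of_subs`. The join with the sector is the trivial
seam `S → (Σ → S)`; the content is `hodgeConjecture_of_subs` (André + BFNP + Lefschetz (1,1)), and no
child alone yields `S` or the crux (BC2(c) probe files `bc/*_probe_*.lean`).
[cite: Andre1996Motifs, §0.3–0.4] -/
theorem summitOffWeilSector_of_subs
    (hM : ∀ ⦃n : ℕ⦄ ⦃X : Literature.AlgebraicGeometry.Motives.SchemeOver ℂ⦄,
      Literature.AlgebraicGeometry.Motives.IsSmoothProjective n X → ∀ p : ℕ, 2 ≤ p → 2 * p ≤ n →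
        ∀ c : Literature.AlgebraicGeometry.HodgeTheory.complexBetti X (2 * p),
          Literature.AlgebraicGeometry.HodgeTheory.IsRationalClass c →
            Literature.AlgebraicGeometry.HodgeTheory.IsOfHodgeType n X (2 * p) p p c →
              c ∈ Literature.AlgebraicGeometry.HodgeTheory.motivatedClasses n X p)
    (hB : ∀ (d : ℕ) (Z : Literature.AlgebraicGeometry.Motives.SchemeOver ℂ)
      (η : Literature.AlgebraicGeometry.HodgeTheory.complexBetti Z 2),
      Literature.AlgebraicGeometry.Motives.IsSmoothProjective d Z →
        Literature.AlgebraicGeometry.HodgeTheory.StandardConjectureBStar d Z η)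
    (hΔ : ∀ ⦃d : ℕ⦄ ⦃V : Literature.AlgebraicGeometry.Motives.SchemeOver ℂ⦄,
      Literature.AlgebraicGeometry.Motives.IsSmoothProjective d V → ∀ (p : ℕ)
        ⦃c : Literature.AlgebraicGeometry.HodgeTheory.complexBetti (V ⊗ V) (2 * p)⦄,
        c ∈ Literature.AlgebraicGeometry.HodgeTheory.algebraicClasses (V ⊗ V) p →
          Literature.AlgebraicGeometry.HodgeTheory.complexBetti.map (lift (𝟙 V) (𝟙 V)) (2 * p) c ∈
            Literature.AlgebraicGeometry.HodgeTheory.algebraicClasses V p) :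
    Summit.HodgeConjecture.HodgeConjecture.Theses.HeckePrymWeil.SummitOffWeilSector :=
  fun _hWeilSector ↦ hodgeConjecture_of_subs hM hB hΔ

/-- **The split glue as a composition of two LANDED theorems** (the BC2(b) certificate in its
strongest form): `Theorems.HodgeBeyondAnchors.hodgeConjecture_of_motivated_of_standardConjectureB`
(André's split of the summit, landed for the sibling crux `HodgeBeyondAnchors`, stmt-14054 —
hypotheses verbatim the three children) followed by the trivial seam `S → (Σ → S)` (landed for the
`HeckeOrbitCompactness` copy of this shared item as the demotion theorem
`Theorems.heckeOrbitCompactness_summitOffWeilSector_of_hodgeConjecture`, which triggered this re-audit). [cite: Andre1996Motifs, §0.3–0.4] -/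
theorem summitOffWeilSector_of_subs'
    (hM : ∀ ⦃n : ℕ⦄ ⦃X : Literature.AlgebraicGeometry.Motives.SchemeOver ℂ⦄,
      Literature.AlgebraicGeometry.Motives.IsSmoothProjective n X → ∀ p : ℕ, 2 ≤ p → 2 * p ≤ n →
        ∀ c : Literature.AlgebraicGeometry.HodgeTheory.complexBetti X (2 * p),
          Literature.AlgebraicGeometry.HodgeTheory.IsRationalClass c →
            Literature.AlgebraicGeometry.HodgeTheory.IsOfHodgeType n X (2 * p) p p c →
              c ∈ Literature.AlgebraicGeometry.HodgeTheory.motivatedClasses n X p)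
    (hB : ∀ (d : ℕ) (Z : Literature.AlgebraicGeometry.Motives.SchemeOver ℂ)
      (η : Literature.AlgebraicGeometry.HodgeTheory.complexBetti Z 2),
      Literature.AlgebraicGeometry.Motives.IsSmoothProjective d Z →
        Literature.AlgebraicGeometry.HodgeTheory.StandardConjectureBStar d Z η)
    (hΔ : ∀ ⦃d : ℕ⦄ ⦃V : Literature.AlgebraicGeometry.Motives.SchemeOver ℂ⦄,
      Literature.AlgebraicGeometry.Motives.IsSmoothProjective d V → ∀ (p : ℕ)
        ⦃c : Literature.AlgebraicGeometry.HodgeTheory.complexBetti (V ⊗ V) (2 * p)⦄,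
        c ∈ Literature.AlgebraicGeometry.HodgeTheory.algebraicClasses (V ⊗ V) p →
          Literature.AlgebraicGeometry.HodgeTheory.complexBetti.map (lift (𝟙 V) (𝟙 V)) (2 * p) c ∈
            Literature.AlgebraicGeometry.HodgeTheory.algebraicClasses V p) :
    Summit.HodgeConjecture.HodgeConjecture.Theses.HeckePrymWeil.SummitOffWeilSector :=
  -- the trivial seam `S → (Σ → S)` (for the HeckeOrbitCompactness copy of this shared item it is the
  -- landed demotion theorem `heckeOrbitCompactness_summitOffWeilSector_of_hodgeConjecture`)
  fun _hWeilSector ↦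
    Summit.HodgeConjecture.HodgeConjecture.Theorems.HodgeBeyondAnchors.hodgeConjecture_of_motivated_of_standardConjectureB
      hM hB hΔ

/-- **Candidate proof of the split's GLUE ITEM** as the gate will render it in the route file
(`def SummitOffWeilSectorGlue : Prop := HodgeClassesMotivated → LefschetzStandardB →
DiagonalPullbackAlgebraic → SummitOffWeilSector`, children = the verbatim bodies above): by `exact
summitOffWeilSector_of_subs` (the children `def`s unfold definitionally). A prover lands
`theorem summitOffWeilSectorGlue_proof : HeckePrymWeil.SummitOffWeilSectorGlue := fun hM hB hΔ ↦
summitOffWeilSector_of_subs hM hB hΔ` under `Theorems/HeckePrymWeilSummitOffWeilSectorSplit.lean`. -/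
example :
    (∀ ⦃n : ℕ⦄ ⦃X : Literature.AlgebraicGeometry.Motives.SchemeOver ℂ⦄,
      Literature.AlgebraicGeometry.Motives.IsSmoothProjective n X → ∀ p : ℕ, 2 ≤ p → 2 * p ≤ n →
        ∀ c : Literature.AlgebraicGeometry.HodgeTheory.complexBetti X (2 * p),
          Literature.AlgebraicGeometry.HodgeTheory.IsRationalClass c →
            Literature.AlgebraicGeometry.HodgeTheory.IsOfHodgeType n X (2 * p) p p c →
              c ∈ Literature.AlgebraicGeometry.HodgeTheory.motivatedClasses n X p) →
    (∀ (d : ℕ) (Z : Literature.AlgebraicGeometry.Motives.SchemeOver ℂ)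
      (η : Literature.AlgebraicGeometry.HodgeTheory.complexBetti Z 2),
      Literature.AlgebraicGeometry.Motives.IsSmoothProjective d Z →
        Literature.AlgebraicGeometry.HodgeTheory.StandardConjectureBStar d Z η) →
    (∀ ⦃d : ℕ⦄ ⦃V : Literature.AlgebraicGeometry.Motives.SchemeOver ℂ⦄,
      Literature.AlgebraicGeometry.Motives.IsSmoothProjective d V → ∀ (p : ℕ)
        ⦃c : Literature.AlgebraicGeometry.HodgeTheory.complexBetti (V ⊗ V) (2 * p)⦄,
        c ∈ Literature.AlgebraicGeometry.HodgeTheory.algebraicClasses (V ⊗ V) p →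
          Literature.AlgebraicGeometry.HodgeTheory.complexBetti.map (lift (𝟙 V) (𝟙 V)) (2 * p) c ∈
            Literature.AlgebraicGeometry.HodgeTheory.algebraicClasses V p) →
    Summit.HodgeConjecture.HodgeConjecture.Theses.HeckePrymWeil.SummitOffWeilSector :=
  summitOffWeilSector_of_subs

end Summit.HodgeConjecture.HodgeConjecture.Cruxes.SummitOffWeilSector.SplitGlue

end
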